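import Summits.ABC.IUTFork.LDHSplitBadPrimeWitness
import Literature.NumberTheory.NumberFields.SplitPrimesGaloisClosure
import Literature.IUT.LogVolume.DifferentConductorTower
import HarnessLib

/-!
# The fork at [IUTchIII] Corollary 3.12, L-DH level: the bad-mass threshold `1/2` suffices for EVERY `l`, and the TRUE side of
# the fork is WITNESSED OVER EVERY NUMBER FIELD OTHER THAN `ℚ` (a completely split prime exists by the tree's Chebotarev)

Proof-only companion (D-0012; 0 definitions, no `Prop` fact) of abc-iut-c312-3's `GenuineLogThetaSplitBadPrimes.lean` /
`LDHSplitBadPrimeWitness.lean` (item «XXVIIc-DH»), by the WAVE-5 prover abc-iut-w5-d018 (gen 4). TAKES NO SIDE on [IUTchIII]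
Cor. 3.12.

abc-iut-c312-3 proved: (a) `ThetaVolumeInput.cor312Of_of_badMass_le` — if `c_p := (1/ℓ⋇)·Σ_{i<ℓ⋇} (i+1)²·β_p^{i+1} ≤ 1` at every
support prime (`β_p` = the bad mass over `p`) then `Cor312NonarchOf I` and `Cor312Of I`; (b) the TERMWISE corollary
`cor312Of_of_badMass_le_third` (`β_p ≤ 1/3`, since `(i+1)²/3^{i+1} ≤ 1`); (c) `cor312Of_deepAtPlace` — for the synthetic
one-bad-place input `deepAtPlace p v₀ l N σ`, `3·n_{v₀} ≤ [F₀:ℚ]` ⇒ `Cor312Of` at EVERY depth — recording «the arithmetic hypothesis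
`3·n_{v₀} ≤ [F₀:ℚ]` … is NOT instantiated on a concrete number field here». THIS FILE:

* `sum_sq_half_pow_le` — the elementary bound `Σ_{i<m} (i+1)²·(1/2)^{i+1} ≤ m` for EVERY `m` (the terms `n²/2^n` are `≤ 1`
  for `n ≥ 4` by `n² ≤ 2^n`, and the first three terms `1/2 + 1 + 9/8 = 21/8 ≤ 3 − 3/8`), whence
  **`ThetaVolumeInput.cor312Of_of_badMass_le_half`** — `β_p ≤ 1/2` at every support prime ⇒ `Cor312NonarchOf ∧ Cor312Of`,
  for EVERY `ℓ⋇` (the sharp-in-`β` uniform form of (b): at `β = 1/2` the averaged coefficient peaks at `29/32 < 1` for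
  `ℓ⋇ = 4`), and **`cor312Of_deepAtPlace_half`** — (c) under `2·n_{v₀} ≤ [F₀:ℚ]`;
* `localDegree_eq_one_of_splitsCompletely` — classical: if `p` splits completely in `F`, every place `v | p` has
  `n_v = e_v·f_v = 1` (`e_v = 1` by Mathlib's `Algebra.IsUnramifiedIn.ramificationIdx_eq_one` through the cell's `ramIdx_eq`;
  `f_v = 1` from `|κ(v)| = p = p^{f_v}`); `exists_place_two_mul_localDegree_le` — EVERY number field `F` with `2 ≤ [F:ℚ]` has a
  place `v₀` with `2·n_{v₀} ≤ [F:ℚ]`, over a completely split prime, which EXISTS by the tree's kernel-proved consequence of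
  the Chebotarev density theorem `Literature.NumberTheory.NumberFields.exists_splitsCompletely` ([FrdI] Thm. 6.4 (iv) lineage);
* **`exists_cor312Of_deepAtPlace_of_two_le_finrank`** — for EVERY number field `F₀ ≠ ℚ` (`2 ≤ [F₀:ℚ]`), every number field
  `K ⊇ F₀` with a place section `σ`, every prime `l ≥ 5`: there are `p` and `v₀ | p` such that for EVERY depth `N`,
  Dupuy–Hilado's (1.1) (`Cor312NonarchOf`) and [IUTchIII] Cor. 3.12 as typed (`Cor312Of`) HOLD for `deepAtPlace p v₀ l N σ`;
  **`exists_deep_cor312Of_of_two_le_finrank`** — the same with UNBOUNDED `q`-degree (for every bound `B` some depth has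
  `deĝ̲(𝔮) > B`) and the DH form for the datum; **`exists_deep_cor312Of_self_of_two_le_finrank`** — the fully closed existence
  statement over `F₀` alone (`K := F₀`, a place section exists by `PlaceSection.nonempty`).

So the cell's sharp Dupuy–Hilado-level fork at synthetic genuine-completion inputs now reads, kernel-checked on both sides:
«`F₀ = ℚ` (`[F₀:ℚ] = 1`): deep ⇒ `Cor312Of` FALSE» (abc-iut-w5-d157 `exists_deepAt_not_cor312Of`) versus «EVERY `F₀ ≠ ℚ`: at a
completely split bad prime `Cor312Of` is TRUE at EVERY depth» (this file) — place combinatorics of `(F₀, 𝕍^bad)`, orthogonal to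
the dispute; and the route to `Summit.ABC` runs over `F_mod = ℚ`.

HONEST SCOPE (as the parent files): SYNTHETIC inhabitants of the input type (not the Θ-volume input of initial Θ-data);
theorems about OUR typed objects ((Ind1) = all capsule-index permutations, HOME/plan/c312/STEPV-IND1-NOTE.md ruling R2 — under
a last-slot-only reading of (Ind1) the slot-choice lower bound is the bad-mass-free «free inequality» and no such TRUE side is
derived); nothing here bears on whether [IUTchIII] Thm. 3.11 licenses (1.1); no side taken; typed ≠ proved for every disputed
claim. [cite: DupuyHilado2025, §1 (1.1), §3.6] [cite: Mochizuki2012, IUTchIII Cor. 3.12 p. 173–174]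
[cite: MochizukiFrdI2008, Thm. 6.4 (iv) p.116] [claim: Mochizuki2012, status: disputed] for every IUT quotation.
-/

noncomputable section

open Finset NumberField IsDedekindDomain Ideal Literature.IUT.LogVolume
open Literature.NumberTheory.GaloisRepresentations Literature.NumberTheory.NumberFields

namespace Summit.ABC.IUTFork

/-! ## The elementary bound behind the threshold `1/2` -/

namespace SplitBadPrime

/-- `n² ≤ 2^n` for `n ≥ 4`. [folklore] -/
theorem sq_le_two_pow_of_four_le (n : ℕ) (hn : 4 ≤ n) : n ^ 2 ≤ 2 ^ n := by
  induction n, hn using Nat.le_induction with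
  | base => norm_num
  | succ k hk ih =>
    have h2 : 2 * k + 1 ≤ 2 ^ k := by
      have : 2 * k + 1 ≤ k ^ 2 := by nlinarith
      exact this.trans ih
    calc (k + 1) ^ 2 = k ^ 2 + (2 * k + 1) := by ring
      _ ≤ 2 ^ k + 2 ^ k := Nat.add_le_add ih h2
      _ = 2 ^ (k + 1) := by ring

/-- `Σ_{n<m} (n+1)²·(1/2)^{n+1} ≤ m` for every `m` (range form): the terms are `≤ 1` from the fourth on, and
`1/2 + 1 + 9/8 ≤ 3 − 3/8`. [folklore] -/
theorem sum_range_sq_half_pow_le (m : ℕ) :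
    ∑ n ∈ range m, (((n : ℝ) + 1) ^ 2 * (1 / 2 : ℝ) ^ (n + 1)) ≤ (m : ℝ) := by
  have hterm : ∀ n : ℕ, 3 ≤ n → ((n : ℝ) + 1) ^ 2 * (1 / 2 : ℝ) ^ (n + 1) ≤ 1 := by
    intro n hn
    have h := sq_le_two_pow_of_four_le (n + 1) (by omega)
    have h' : ((n : ℝ) + 1) ^ 2 ≤ (2 : ℝ) ^ (n + 1) := by exact_mod_cast h
    have hpos : (0 : ℝ) < (2 : ℝ) ^ (n + 1) := by positivity
    rw [one_div, inv_pow, ← div_eq_mul_inv, div_le_one hpos]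
    exact h'
  have key : ∀ m : ℕ, 3 ≤ m →
      ∑ n ∈ range m, (((n : ℝ) + 1) ^ 2 * (1 / 2 : ℝ) ^ (n + 1)) ≤ (m : ℝ) - 3 / 8 := by
    intro m hm
    induction m, hm using Nat.le_induction with
    | base => simp [sum_range_succ]; norm_num
    | succ k hk ih =>
      rw [sum_range_succ]
      have := hterm k hk
      push_cast
      linarith
  rcases Nat.lt_or_ge m 3 with hm | hm
  · interval_cases m <;> simp [sum_range_succ] <;> norm_num
  · have := key m hm
    linarith

/-- **`Σ_{i<m} (i+1)²·(1/2)^{i+1} ≤ m`** (`Fin` form) — the averaged coefficient `(1/ℓ⋇)Σ_{i<ℓ⋇}(i+1)²·(1/2)^{i+1}` of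
abc-iut-c312-3's bad-mass condition at `β = 1/2` is `≤ 1` for EVERY `ℓ⋇`. [folklore] -/
theorem sum_sq_half_pow_le (m : ℕ) :
    ∑ i : Fin m, ((((i : ℕ) : ℝ) + 1) ^ 2 * (1 / 2 : ℝ) ^ ((i : ℕ) + 1)) ≤ (m : ℝ) := by
  rw [Fin.sum_univ_eq_sum_range (fun n => (((n : ℝ) + 1) ^ 2 * (1 / 2 : ℝ) ^ (n + 1))) m]
  exact sum_range_sq_half_pow_le m

end SplitBadPrime

/-! ## The bad-mass threshold `1/2`, for every `l` -/

section Half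

variable {F₀ : Type} [Field F₀] [NumberField F₀] {K : Type} [Field K] [NumberField K] [Algebra F₀ K]
/-- **[IUTchIII] Cor. 3.12 (the tree's sharp Dupuy–Hilado-level `Cor312Of`) HOLDS for every genuine Θ-volume input whose bad
places over each rational prime carry at most HALF of the degree** — `β_p = Σ_{v|p, v∈𝕍^bad} n_v/[F₀:ℚ] ≤ 1/2` at every support
prime `p` ⇒ `Cor312NonarchOf I` and `Cor312Of I`, whatever the depths, `l`, `K`, the ideles: abc-iut-c312-3's
`cor312Of_of_badMass_le` with `(1/ℓ⋇)Σ_i (i+1)²·β_p^{i+1} ≤ (1/ℓ⋇)Σ_i (i+1)²·(1/2)^{i+1} ≤ 1` (`sum_sq_half_pow_le`). A theorem about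
OUR typed objects ((Ind1) = all capsule-index permutations); no side taken on print's Cor. 3.12.
[claim: Mochizuki2012, status: disputed] [cite: DupuyHilado2025, §3.6, §4.7, §4.12] -/
theorem ThetaVolumeInput.cor312Of_of_badMass_le_half (I : ThetaVolumeInput F₀ K)
    (h : ∀ p ∈ I.supportPrimes,
      ∑ v : placesOver F₀ p, (I.X.S : Set (HeightOneSpectrum (𝓞 F₀))).indicator (weight F₀) v.1 ≤ 1 / 2) :
    I.Cor312NonarchOf ∧ I.Cor312Of := by
  have hc : ∀ p ∈ I.supportPrimes, (1 / (I.lstar : ℝ)) * ∑ i : Fin I.lstar, (((i : ℕ) + 1 : ℝ) ^ 2) *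
      (∑ v : placesOver F₀ p, (I.X.S : Set (HeightOneSpectrum (𝓞 F₀))).indicator (weight F₀) v.1) ^ ((i : ℕ) + 1) ≤ 1 := by
    intro p hpT
    have hβ0 := I.badMass_nonneg p
    have hβ := h p hpT
    have hsum : ∑ i : Fin I.lstar, (((i : ℕ) + 1 : ℝ) ^ 2) *
        (∑ v : placesOver F₀ p, (I.X.S : Set (HeightOneSpectrum (𝓞 F₀))).indicator (weight F₀) v.1) ^ ((i : ℕ) + 1) ≤
        I.lstar := by
      calc ∑ i : Fin I.lstar, (((i : ℕ) + 1 : ℝ) ^ 2) *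
            (∑ v : placesOver F₀ p, (I.X.S : Set (HeightOneSpectrum (𝓞 F₀))).indicator (weight F₀) v.1) ^ ((i : ℕ) + 1)
          ≤ ∑ i : Fin I.lstar, ((((i : ℕ) : ℝ) + 1) ^ 2 * (1 / 2 : ℝ) ^ ((i : ℕ) + 1)) :=
            Finset.sum_le_sum fun i _ =>
              mul_le_mul_of_nonneg_left (pow_le_pow_left₀ hβ0 hβ _) (sq_nonneg _)
        _ ≤ I.lstar := SplitBadPrime.sum_sq_half_pow_le I.lstar
    rcases Nat.eq_zero_or_pos I.lstar with h0 | hpos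
    · rw [h0]; simp
    · have hl : (0 : ℝ) < I.lstar := by exact_mod_cast hpos
      rw [one_div, inv_mul_le_iff₀ hl, mul_one]
      exact hsum
  exact ⟨I.cor312NonarchOf_of_badMass_le hc, I.cor312Of_of_badMass_le hc⟩

end Half

/-! ## Classical input: completely split primes give places of local degree one -/

section Classical

variable {F : Type} [Field F] [NumberField F]

/-- **If `p` splits completely in `F`, every place `v | p` of `F` has local degree `n_v = e_v·f_v = 1`**: `e_v = 1` because `p`
is unramified (Mathlib `Algebra.IsUnramifiedIn.ramificationIdx_eq_one`, through the cell's `ramIdx_eq`), `f_v = 1` because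
`|κ(v)| = p` while `|κ(v)| = p^{f_v}` (`absNorm_eq`). Classical. [cite: Marcus2018, Ch. 4 (before Thm. 29)] -/
theorem localDegree_eq_one_of_splitsCompletely {p : ℕ} [hp : Fact p.Prime] (h : SplitsCompletely F p)
    {v : HeightOneSpectrum (𝓞 F)} (hv : v ∈ placesOver F p) : localDegree F v = 1 := by
  have hchar : residueChar F v = p := (mem_placesOver_iff_residueChar v).mp hv
  haveI hlies : v.asIdeal.LiesOver (Ideal.span {(p : ℤ)}) := (mem_placesOver_iff v).mp hv
  haveI := v.isPrime
  -- `e_v = 1`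
  have he : ramIdx F v = 1 := by
    rw [ramIdx_eq F v]
    exact h.1.ramificationIdx_eq_one hlies
  -- `f_v = 1`
  have hf : resDeg F v = 1 := by
    have h1 : Ideal.absNorm v.asIdeal = p := h.2 v (natCast_mem_of_liesOver_span hlies)
    have h2 : Ideal.absNorm v.asIdeal = residueChar F v ^ resDeg F v := absNorm_eq F v
    rw [hchar, h1] at h2
    have h3 : p ^ resDeg F v = p ^ 1 := by rw [pow_one]; exact h2.symm
    exact Nat.pow_right_injective hp.out.two_le h3
  rw [localDegree, he, hf]

variable (F) in
/-- **EVERY number field `F ≠ ℚ` (`2 ≤ [F:ℚ]`) has a place `v₀` with `2·n_{v₀} ≤ [F:ℚ]`** — over a completely split rational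
prime (which exists by the tree's Chebotarev consequence `exists_splitsCompletely`), every place has `n_{v₀} = 1`.
[cite: MochizukiFrdI2008, Thm. 6.4 (iv) p.116] -/
theorem exists_place_two_mul_localDegree_le (h2 : 2 ≤ Module.finrank ℚ F) :
    ∃ (p : ℕ) (_ : Fact p.Prime) (v₀ : placesOver F p), 2 * localDegree F v₀.1 ≤ Module.finrank ℚ F := by
  obtain ⟨p, hp, hsplit⟩ := exists_splitsCompletely F
  haveI : Fact p.Prime := ⟨hp⟩
  obtain ⟨w, hw⟩ := placesOver_nonempty F p
  refine ⟨p, inferInstance, ⟨w, hw⟩, ?_⟩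
  rw [localDegree_eq_one_of_splitsCompletely hsplit hw, mul_one]
  exact h2

end Classical

/-! ## The TRUE side of the fork over every number field other than `ℚ` -/

section Witness

variable {F₀ : Type} [Field F₀] [NumberField F₀] {K : Type} [Field K] [NumberField K] [Algebra F₀ K]

/-- **`Cor312Of` HOLDS AT EVERY DEPTH for the synthetic input deep at a place carrying at most HALF of the degree**
(`2·n_{v₀} ≤ [F₀:ℚ]`): abc-iut-c312-3's `cor312Of_deepAtPlace` with the threshold `1/3` replaced by `1/2`
(`ThetaVolumeInput.cor312Of_of_badMass_le_half`; the input's bad mass at every prime is `≤ Pr(v₀) = n_{v₀}/[F₀:ℚ]`). SYNTHETIC input; typed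
objects; no side taken. [claim: Mochizuki2012, status: disputed] [cite: DupuyHilado2025, §1 (1.1), §3.6] -/
theorem cor312Of_deepAtPlace_half (p : ℕ) [Fact p.Prime] (v₀ : placesOver F₀ p) (l : ℕ) (hl : l.Prime) (h5 : 5 ≤ l)
    (N : ℕ) (hN : 0 < N) (σ : PlaceSection F₀ K) (h2 : 2 * localDegree F₀ v₀.1 ≤ Module.finrank ℚ F₀) :
    (ThetaVolumeInput.deepAtPlace p v₀ l hl h5 N hN σ).Cor312NonarchOf ∧
      (ThetaVolumeInput.deepAtPlace p v₀ l hl h5 N hN σ).Cor312Of := by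
  refine ThetaVolumeInput.cor312Of_of_badMass_le_half (ThetaVolumeInput.deepAtPlace p v₀ l hl h5 N hN σ) fun p' _ => ?_
  refine (ThetaVolumeInput.deepAtPlace_badMass_le p v₀ l hl h5 N hN σ p').trans ?_
  have hF : (0 : ℝ) < Module.finrank ℚ F₀ := by exact_mod_cast Module.finrank_pos
  have h2' : (2 : ℝ) * localDegree F₀ v₀.1 ≤ Module.finrank ℚ F₀ := by exact_mod_cast h2
  rw [weight, div_le_div_iff₀ hF (by norm_num : (0 : ℝ) < 2), one_mul]
  linarith

/-- **[IUTchIII] Cor. 3.12 (the tree's sharp DH-level `Cor312Of`) HOLDS AT EVERY DEPTH at a suitable synthetic input over EVERY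
number field other than `ℚ`**: for `F₀` with `2 ≤ [F₀:ℚ]`, any number field `K ⊇ F₀` with a place section `σ`, any prime `l ≥ 5`,
there are a rational prime `p` and a place `v₀ | p` of `F₀` (of local degree one, over a completely split prime — the tree's
Chebotarev) such that for every depth `N`, `Cor312NonarchOf` and `Cor312Of` hold for abc-iut-c312-3's one-bad-place input
`deepAtPlace p v₀ l N σ`. SYNTHETIC inputs; typed objects; no side taken on print's Cor. 3.12.
[claim: Mochizuki2012, status: disputed] [cite: DupuyHilado2025, §1 (1.1), §3.6] [cite: MochizukiFrdI2008, Thm. 6.4 (iv) p.116] -/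
theorem exists_cor312Of_deepAtPlace_of_two_le_finrank (h2 : 2 ≤ Module.finrank ℚ F₀)
    (σ : PlaceSection F₀ K) (l : ℕ) (hl : l.Prime) (h5 : 5 ≤ l) :
    ∃ (p : ℕ) (_ : Fact p.Prime) (v₀ : placesOver F₀ p), ∀ (N : ℕ) (hN : 0 < N),
      (ThetaVolumeInput.deepAtPlace p v₀ l hl h5 N hN σ).Cor312NonarchOf ∧
        (ThetaVolumeInput.deepAtPlace p v₀ l hl h5 N hN σ).Cor312Of := by
  obtain ⟨p, hp, v₀, hv₀⟩ := exists_place_two_mul_localDegree_le F₀ h2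
  exact ⟨p, hp, v₀, fun N hN => cor312Of_deepAtPlace_half p v₀ l hl h5 N hN σ hv₀⟩

/-- **… with UNBOUNDED `q`-degree and the Dupuy–Hilado form**: over every `F₀ ≠ ℚ` (any `K ⊇ F₀`, `σ`, prime `l ≥ 5`) there are
`p`, `v₀ | p` such that for every bound `B` some depth `N` gives a synthetic input with `deĝ̲(𝔮) > B`, `Cor312NonarchOf`,
`Cor312Of`, and Dupuy–Hilado's (1.1) for its DH datum — the TRUE side of the fork is not a shallow-regime phenomenon.
[claim: Mochizuki2012, status: disputed] [cite: DupuyHilado2025, §1 (1.1), §3.3, §3.6] -/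
theorem exists_deep_cor312Of_of_two_le_finrank (h2 : 2 ≤ Module.finrank ℚ F₀)
    (σ : PlaceSection F₀ K) (l : ℕ) (hl : l.Prime) (h5 : 5 ≤ l) :
    ∃ (p : ℕ) (_ : Fact p.Prime) (v₀ : placesOver F₀ p), ∀ B : ℝ, ∃ (N : ℕ) (hN : 0 < N),
      B < FinDivisor.ndeg F₀ (ThetaVolumeInput.deepAtPlace p v₀ l hl h5 N hN σ).X.qDivisor ∧
        (ThetaVolumeInput.deepAtPlace p v₀ l hl h5 N hN σ).Cor312NonarchOf ∧
        (ThetaVolumeInput.deepAtPlace p v₀ l hl h5 N hN σ).Cor312Of ∧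
        (DHData.ofInput (ThetaVolumeInput.deepAtPlace p v₀ l hl h5 N hN σ)).Cor312DH := by
  obtain ⟨p, hp, v₀, hv₀⟩ := exists_place_two_mul_localDegree_le F₀ h2
  refine ⟨p, hp, v₀, fun B => ?_⟩
  obtain ⟨N, hN, hB⟩ := ThetaVolumeInput.exists_deepAtPlace_ndeg_qDivisor_gt p v₀ l hl h5 σ B
  have h := cor312Of_deepAtPlace_half p v₀ l hl h5 N hN σ hv₀
  exact ⟨N, hN, hB, h.1, h.2, (DHData.cor312DH_ofInput_iff _).mpr h.1⟩

/-- **Fully closed form over `F₀` alone** (`K := F₀`; a place section exists, `PlaceSection.nonempty`): for EVERY number field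
`F₀ ≠ ℚ` and every prime `l ≥ 5` there is a synthetic Θ-volume input over `F₀` of ARBITRARILY LARGE `q`-degree at which `Cor312Of`
HOLDS. Contrast (the other side of the fork): over `F₀ = ℚ` abc-iut-w5-d157's `exists_deepAt_not_cor312Of` gives deep synthetic
inputs at which `Cor312Of` FAILS. Place combinatorics of `(F₀, 𝕍^bad)`, orthogonal to the dispute; typed objects ((Ind1) = all
capsule-index permutations); no side taken. [claim: Mochizuki2012, status: disputed] [cite: DupuyHilado2025, §1 (1.1), §3.6] -/
theorem exists_deep_cor312Of_self_of_two_le_finrank (F₀ : Type) [Field F₀] [NumberField F₀]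
    (h2 : 2 ≤ Module.finrank ℚ F₀) (l : ℕ) (hl : l.Prime) (h5 : 5 ≤ l) (B : ℝ) :
    ∃ I : ThetaVolumeInput F₀ F₀, B < FinDivisor.ndeg F₀ I.X.qDivisor ∧ I.Cor312NonarchOf ∧ I.Cor312Of := by
  obtain ⟨σ⟩ := PlaceSection.nonempty F₀ F₀
  obtain ⟨p, hp, v₀, h⟩ := exists_deep_cor312Of_of_two_le_finrank (K := F₀) h2 σ l hl h5
  obtain ⟨N, hN, hB, h1, h2', -⟩ := h B
  exact ⟨_, hB, h1, h2'⟩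

end Witness

end Summit.ABC.IUTFork

end
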